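import Literature.AnabelianGeometry.EtaleTheta.ArithThetaTowerCor38iiPull
import Literature.AnabelianGeometry.EtaleTheta.ArithThetaTowerCarrierProp34
import Literature.AnabelianGeometry.EtaleTheta.ArithThetaTowerIsFrobenioid
import HarnessLib

/-!
# [EtTh] Cor. 3.8 (ii) at the ARITHMETIC theta towers, in print's TWO-OBJECT generality `Ψ : C₁ ⥲ C₂`, and
# RESIDUAL-FREE at GA-03's realified data `T' := ArithThetaTower.realified d T` (GAP A item GA-14 = D8 part 2, gen-2 rider)

S. Mochizuki, *The étale theta function and its Frobenioid-theoretic manifestations*, Publ. RIMS **45** (2009)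
[MochizukiEtTh2009]: Cor. 3.8 PDF pp. 80–81 ("for `i = 1, 2`, let `C_i` be a tempered Frobenioid … whose base category
`D_i` is of FSMFF-type, and whose divisor monoid `Φ_i` is non-dilating.  Let `Ψ : C₁ ⥲ C₂` be an equivalence of
categories. … (ii) Suppose … `D_i` … is Div-slim … Then `Ψ` preserves the base-field-theoretic morphisms and induces a
compatible equivalence `C₁^{bs-fld} ⥲ C₂^{bs-fld}`"), its proof p. 81, Remark 3.6.3 pp. 78–79, Prop. 3.4 (ii) p. 74,
Remark 3.3.1 p. 73 [cite: MochizukiEtTh2009, Cor 3.8 p.81]; *Inter-universal Teichmüller theory I*, Example 3.2 (iii)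
p. 71 ("`𝒞_v ⊆ ℱ̲_v` … may be reconstructed category-theoretically from `ℱ̲_v` [cf. [EtTh], Corollary 3.8, (ii)]").

GAP A of record G-L5-EX32I-1 (abc-iut cell), item GA-14 (`plan/GAP-ITEMS.tsv` v1.0 row GA-14; RULINGS #317 (2) as amended
by #319 (c1)–(c4) / #322 (c2′)/(c3′); ruled shapes `plan/L5/GAP-A-SIGNATURES.md` v2 bd8d4ceaa15d54d7 §0/§5/§8 D8;
GAP-SIZING-A.md 69de97346848d3e8 §2 D8).  A PROOF-ONLY RIDER to GA-14's ★ p670391 `ArithThetaTowerCor38ii.lean`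
(`cor38ii_h5_of_carrierSpec`, `cor38ii_hR`) and ★ p671786 `ArithThetaTowerCor38iiPull.lean` (the SELF-equivalence
one-call `hull_selfEquivalence_of_carrierSpec_of_pullDichotomy[_of_isSlimGroup]`), both byte-untouched and imported.
Everything is stated over the §5 BINDERS `(C) (hC : CarrierSpec d T C) (hD : CarrierSpec.PullDichotomy C)` — here
once per side — never over the term `temperedFrobenioid d T` (GA-12; D7 = GA-07 instantiates).  Two additions
(SIG-DELTA GA-14 gen 2, reported):

* §1 **print's TWO-OBJECT generality** — `hull_equivalence_of_carrierSpec_of_pullDichotomy[_of_isSlimGroup]`: for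
  tempered Frobenioids `C₁`, `C₂` over `𝒟_{v̲,i} = CosetCat Π_i` on generic realified data `T'_i`, each satisfying
  S0 and the pull-back dichotomy, and ANY equivalence `Ψ : C₁ ⥲ C₂`: `Ψ` preserves the base-field-theoretic morphisms
  AND induces a compatible equivalence `Ψbs : C₁^{bs-fld} ⥲ C₂^{bs-fld}` of the REAL hull categories
  (`hull₁ ⋙ Ψ ≅ Ψbs ⋙ hull₂`) — abc-iut-w6-d040/abc-iut-L2-t3's two-object knit `Cor38Hyp.cor38_ii_weak_of_criteria`
  (`Discharge/Sec3Cor38iiWeak.lean`) fed per side, BY NAME, with `isOfFSMFFType_Dv` ([FrdII] Ex. 1.3 (i)), GA-08's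
  `isNonDilating_of_carrierSpec hC_i hD_i` (`hnd_i`), GA-14's `cor38ii_h5_of_carrierSpec` / `cor38ii_hR` (`h5_i`,
  `hR_i`), and ★ p511706's `BadLocalFrobenioid.divSlim_cosetCat_of_isSlimGroup` (`hds_i`); modulo `hF_i` (GA-05's
  result type) and the three `T'_i`-level print clauses r1 `hP34Λ_i` / r3 `hZQ_i` / r2 `hFinv_i` per side.  The
  self-equivalence form of ★ p671786 is the case `C₁ = C₂`.
* §2–§3 **RESIDUAL-FREE at the ARITHMETIC realified data** `T'_i := realified d_i T_i = ofRlfZWeak (divisorMonoids d_i T_i) _`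
  (GA-03 ★ p672371): r1–r3 are THEOREMS there — GA-02's ADD-ON 2 ★ p676754 `realified_mem_FΛ_of_divΛ_eq_of` (Prop. 3.4
  (ii), isomorphism 2, at the ⊕ carrier), `realified_isZQMonoprime` (Rmk. 3.3.1), `realified_exists_inv_FΛ` (`F₀` a
  group), BY NAME — so over `{C : TemperedFrobenioid (realified d T) T.Dv VD} (hC) (hD)`: `cor38ii_h5_of_carrierSpec_realified
  (hC) (hF)` (row C38-L05 at THE perfection, modulo `hF` only), `cor38ii_hR_realified (C)` (Rmk. 3.6.3 OUTRIGHT), the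
  two-object / self-equivalence one-calls modulo `hF_i` only (§2), and at the tree category vocabulary
  `treeCatVocab T.Dv r s` (GA-04's `catVocab d T` is `r = s = ⊤`), where `hF` is GA-05's hypothesis-free
  `isFrobenioid_realifiedOf` ★ p669819 (`realified d T = realifiedOf d T (deckAction d T) _` by `rfl`):
  **`hull_equivalence_realified_treeCatVocab_of_isSlimGroup (hC₁) (hD₁) (hC₂) (hD₂) (hP₁) (hZ₁) (hP₂) (hZ₂) (Ψ)`** and
  **`hull_selfEquivalence_realified_treeCatVocab_of_isSlimGroup (hC) (hD) (hP) (hZ) (e)`** — [EtTh] Cor. 3.8 (ii) for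
  EVERY equivalence between ANY two (resp. every self-equivalence of any) tempered Frobenioid(s) over
  `𝒟_v̲ = CosetCat Π_v̲` on the arithmetic realified data satisfying S0 and the pull-back dichotomy, `Π` tempered and
  slim — MODULO NOTHING ELSE (§3).  D7 (GA-07) may one-call §2/§3 at the term with GA-12's
  `carrierSpec_temperedFrobenioid` / `pullDichotomy_temperedFrobenioid` ★ p675527 (`h5`/`hR` there:
  `cor38ii_h5_of_carrierSpec_realified (carrierSpec_temperedFrobenioid d T) hF`, `cor38ii_hR_realified _`);
  TODO-merge(abc-iut-gapA-07-badTemperedRestArithKnit) — nothing here blocks the knit, which may equally feed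
  ★ p670391/★ p671786 with GA-02's three names directly (spec-keeper A, l.121973).

PROOF-ONLY: 0 definitions, 0 instances, 0 notation, 0 attribute manipulation, 0 `sorry`; compositions of landed
theorems BY NAME.

HONEST FRAMING: refereed pre-IUT material ([EtTh] §3 over [FrdI] §§0–5, [FrdII] Ex. 1.3) instantiated at OUR typed
objects (GA-02's (c3′)-labelled carrier: genuine-by-[EtTh]-recipe on the `T`-lattice + constants everywhere;
off-lattice `Φ` via `rebase`/pullback; print's `Ÿ̈`/`μ_N` Kummer levels = FOUNDATIONS 13/14, not claimed); an
UNDISPUTED construction step around [IUTchIII] Cor. 3.12, which stays OPEN by charter (D-0045) — no side is taken on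
it or on any author; typed ≠ inhabited ≠ proved-in-print (`hC`/`hD` at the carrier are GA-12's theorems, not assumed
inhabited here; an equivalence `Ψ` is a HYPOTHESIS, none is constructed); nothing here asserts the abc conjecture
proved or refuted; count-neutral; rq128 untouched.
-/

noncomputable section

namespace Literature.AnabelianGeometry.EtaleTheta

namespace ArithThetaTower

open CategoryTheory Opposite Function Literature.AlgebraicGeometry.Frobenioids Literature.AnabelianGeometry.SemiGraphs
  Literature.IUT.HodgeTheaters

/-! ## §1 [EtTh] Cor. 3.8 (ii) for an equivalence `Ψ : C₁ ⥲ C₂` of TWO tempered Frobenioids over `𝒟_{v̲,1}`, `𝒟_{v̲,2}` (§5 binders per side) -/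

section TwoObject

variable {p₁ p₂ : ℕ} [Fact p₁.Prime] [Fact p₂.Prime] {d₁ : GaloisValDatum.{0} p₁} {d₂ : GaloisValDatum.{0} p₂}
  {P₁ P₂ : Type} [Group P₁] [TopologicalSpace P₁] [Group P₂] [TopologicalSpace P₂]
  {T₁ : BadLocalGroupDatum d₁.Gal P₁} {T₂ : BadLocalGroupDatum d₂.Gal P₂}
  {T'₁ : RealifiedDivisorMonoids (D₀ := T₁.Dv) treeMonoidVocabWeak.{0}}
  {T'₂ : RealifiedDivisorMonoids (D₀ := T₂.Dv) treeMonoidVocabWeak.{0}}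
  {VD₁ : FrdICatStub.{0, 0, 0} T₁.Dv} {VD₂ : FrdICatStub.{0, 0, 0} T₂.Dv}
  {C₁ : TemperedFrobenioid T'₁ T₁.Dv VD₁} {C₂ : TemperedFrobenioid T'₂ T₂.Dv VD₂}

/-- **[EtTh] Cor. 3.8 (ii) in print's TWO-OBJECT generality at the §5 binders** ("for `i = 1, 2`, let `C_i` be a
tempered Frobenioid … `D_i` of FSMFF-type … `Φ_i` non-dilating.  Let `Ψ : C₁ ⥲ C₂` be an equivalence … Suppose `D_i`
is Div-slim.  Then `Ψ` preserves the base-field-theoretic morphisms and induces a compatible equivalence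
`C₁^{bs-fld} ⥲ C₂^{bs-fld}`", pp. 80–81): for tempered Frobenioids `C_i` over `𝒟_{v̲,i} = CosetCat Π_i` satisfying the
decoupling spec S0 (`hC_i`) and the pull-back dichotomy (`hD_i`), and ANY equivalence `Ψ`, the base-field-theoretic
morphisms are preserved and `Ψ` lifts to an equivalence `Ψbs` of the REAL hull categories with `hull₁ ⋙ Ψ ≅ Ψbs ⋙ hull₂`.
The two-object knit `Cor38Hyp.cor38_ii_weak_of_criteria` (abc-iut-w6-d040 / abc-iut-L2-t3) fed BY NAME per side with
`BadLocalFrobenioid.isOfFSMFFType_Dv` ([FrdII] Ex. 1.3 (i)), GA-08's `isNonDilating_of_carrierSpec hC_i hD_i`, GA-14's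
`cor38ii_h5_of_carrierSpec` / `cor38ii_hR` (★ p670391); modulo, per side, Div-slimness `hds_i`, `hF_i` ([FrdI] Thm. 5.2
(ii); GA-05's result type) and the three `T'_i`-level print clauses `hP34Λ_i` (Prop. 3.4 (ii) at `Λ`), `hZQ_i` (Rmk.
3.3.1), `hFinv_i` (`F₀^Λ` a group).  ★ p671786's self-equivalence one-call is the case `C₁ = C₂`.
[cite: MochizukiEtTh2009, Cor 3.8 p.81] -/
theorem hull_equivalence_of_carrierSpec_of_pullDichotomy [IsTopologicalGroup P₁] [IsTopologicalGroup P₂]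
    (hC₁ : CarrierSpec d₁ T₁ C₁) (hD₁ : CarrierSpec.PullDichotomy C₁)
    (hC₂ : CarrierSpec d₂ T₂ C₂) (hD₂ : CarrierSpec.PullDichotomy C₂)
    (hds₁ : ∀ (A : T₁.Dv) (α : Aut (Over.forget A)),
      (∀ (B : Over A) (x : C₁.divisorMonoid.obj (op B.left)),
        Literature.AlgebraicGeometry.Frobenioids.pull C₁.divisorMonoid (α.hom.app B) x = x) → α = 1)
    (hds₂ : ∀ (A : T₂.Dv) (α : Aut (Over.forget A)),
      (∀ (B : Over A) (x : C₂.divisorMonoid.obj (op B.left)),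
        Literature.AlgebraicGeometry.Frobenioids.pull C₂.divisorMonoid (α.hom.app B) x = x) → α = 1)
    (hF₁ : PreFrobenioid.IsFrobenioid C₁.toElem) (hF₂ : PreFrobenioid.IsFrobenioid C₂.toElem)
    (hP34Λ₁ : ∀ (Y : T₁.Dvᵒᵖ) (b : T'₁.BΛ.obj Y) (r : T'₁.ΦR.obj Y),
      T'₁.divΛ Y b = Algebra.GrothendieckGroup.of r → b ∈ T'₁.FΛ Y)
    (hZQ₁ : ∀ (Y : T₁.Dvᵒᵖ) (𝔭 : Primes (T'₁.Φ₀.obj Y)), IsZMonoprime ↥𝔭.submonoid ∨ IsQMonoprime ↥𝔭.submonoid)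
    (hFinv₁ : ∀ (Y : T₁.Dvᵒᵖ) (b : T'₁.BΛ.obj Y), b ∈ T'₁.FΛ Y → ∃ b' ∈ T'₁.FΛ Y, b' * b = 1)
    (hP34Λ₂ : ∀ (Y : T₂.Dvᵒᵖ) (b : T'₂.BΛ.obj Y) (r : T'₂.ΦR.obj Y),
      T'₂.divΛ Y b = Algebra.GrothendieckGroup.of r → b ∈ T'₂.FΛ Y)
    (hZQ₂ : ∀ (Y : T₂.Dvᵒᵖ) (𝔭 : Primes (T'₂.Φ₀.obj Y)), IsZMonoprime ↥𝔭.submonoid ∨ IsQMonoprime ↥𝔭.submonoid)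
    (hFinv₂ : ∀ (Y : T₂.Dvᵒᵖ) (b : T'₂.BΛ.obj Y), b ∈ T'₂.FΛ Y → ∃ b' ∈ T'₂.FΛ Y, b' * b = 1)
    (Ψ : C₁.category ≌ C₂.category) :
    (∀ {A B : C₁.category} (f : A ⟶ B), C₁.IsBaseFieldTheoretic f ↔ C₂.IsBaseFieldTheoretic (Ψ.functor.map f)) ∧
      ∃ Ψbs : C₁.hullCategory ≌ C₂.hullCategory, Nonempty (C₁.hull ⋙ Ψ.functor ≅ Ψbs.functor ⋙ C₂.hull) :=
  (Cor38Hyp.mk (C₁ := C₁) (C₂ := C₂) Ψ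
      ⟨BadLocalFrobenioid.isOfFSMFFType_Dv d₁ T₁, BadLocalFrobenioid.isOfFSMFFType_Dv d₂ T₂⟩
      ⟨isNonDilating_of_carrierSpec hC₁ hD₁, isNonDilating_of_carrierSpec hC₂ hD₂⟩).cor38_ii_weak_of_criteria
    hF₁ hF₂ (cor38ii_h5_of_carrierSpec hC₁ hF₁ hP34Λ₁ hZQ₁) (cor38ii_h5_of_carrierSpec hC₂ hF₂ hP34Λ₂ hZQ₂)
    (cor38ii_hR C₁ hP34Λ₁ hFinv₁) (cor38ii_hR C₂ hP34Λ₂ hFinv₂) hds₁ hds₂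

/-- **The same with Div-slimness DISCHARGED on both sides from `Π_i` tempered and slim** (★ p511706's
`BadLocalFrobenioid.divSlim_cosetCat_of_isSlimGroup`; [SemiAnbd] Rmk. 3.4.1: `CosetCat Π_i` is then a slim category):
[EtTh] Cor. 3.8 (ii) for every equivalence `Ψ : C₁ ⥲ C₂`, modulo `hF_i` (GA-05's result type) and the three
`T'_i`-level print clauses per side only. [cite: MochizukiEtTh2009, Cor 3.8 p.81] -/
theorem hull_equivalence_of_carrierSpec_of_pullDichotomy_of_isSlimGroup [IsTopologicalGroup P₁]
    [IsTopologicalGroup P₂]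
    (hC₁ : CarrierSpec d₁ T₁ C₁) (hD₁ : CarrierSpec.PullDichotomy C₁)
    (hC₂ : CarrierSpec d₂ T₂ C₂) (hD₂ : CarrierSpec.PullDichotomy C₂)
    (hP₁ : IsTempered P₁) (hZ₁ : IsSlimGroup P₁) (hP₂ : IsTempered P₂) (hZ₂ : IsSlimGroup P₂)
    (hF₁ : PreFrobenioid.IsFrobenioid C₁.toElem) (hF₂ : PreFrobenioid.IsFrobenioid C₂.toElem)
    (hP34Λ₁ : ∀ (Y : T₁.Dvᵒᵖ) (b : T'₁.BΛ.obj Y) (r : T'₁.ΦR.obj Y),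
      T'₁.divΛ Y b = Algebra.GrothendieckGroup.of r → b ∈ T'₁.FΛ Y)
    (hZQ₁ : ∀ (Y : T₁.Dvᵒᵖ) (𝔭 : Primes (T'₁.Φ₀.obj Y)), IsZMonoprime ↥𝔭.submonoid ∨ IsQMonoprime ↥𝔭.submonoid)
    (hFinv₁ : ∀ (Y : T₁.Dvᵒᵖ) (b : T'₁.BΛ.obj Y), b ∈ T'₁.FΛ Y → ∃ b' ∈ T'₁.FΛ Y, b' * b = 1)
    (hP34Λ₂ : ∀ (Y : T₂.Dvᵒᵖ) (b : T'₂.BΛ.obj Y) (r : T'₂.ΦR.obj Y),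
      T'₂.divΛ Y b = Algebra.GrothendieckGroup.of r → b ∈ T'₂.FΛ Y)
    (hZQ₂ : ∀ (Y : T₂.Dvᵒᵖ) (𝔭 : Primes (T'₂.Φ₀.obj Y)), IsZMonoprime ↥𝔭.submonoid ∨ IsQMonoprime ↥𝔭.submonoid)
    (hFinv₂ : ∀ (Y : T₂.Dvᵒᵖ) (b : T'₂.BΛ.obj Y), b ∈ T'₂.FΛ Y → ∃ b' ∈ T'₂.FΛ Y, b' * b = 1)
    (Ψ : C₁.category ≌ C₂.category) :
    (∀ {A B : C₁.category} (f : A ⟶ B), C₁.IsBaseFieldTheoretic f ↔ C₂.IsBaseFieldTheoretic (Ψ.functor.map f)) ∧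
      ∃ Ψbs : C₁.hullCategory ≌ C₂.hullCategory, Nonempty (C₁.hull ⋙ Ψ.functor ≅ Ψbs.functor ⋙ C₂.hull) :=
  hull_equivalence_of_carrierSpec_of_pullDichotomy hC₁ hD₁ hC₂ hD₂
    (BadLocalFrobenioid.divSlim_cosetCat_of_isSlimGroup hP₁ hZ₁ C₁.divisorMonoid)
    (BadLocalFrobenioid.divSlim_cosetCat_of_isSlimGroup hP₂ hZ₂ C₂.divisorMonoid) hF₁ hF₂ hP34Λ₁ hZQ₁ hFinv₁ hP34Λ₂
    hZQ₂ hFinv₂ Ψ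

end TwoObject

/-! ## §2 At the ARITHMETIC realified data `T' := realified d T`: r1–r3 are GA-02's theorems — D8 modulo `hF` only -/

section Realified

variable {p : ℕ} [Fact p.Prime] {d : GaloisValDatum.{0} p} {P : Type} [Group P] [TopologicalSpace P]
  {T : BadLocalGroupDatum d.Gal P} {VD : FrdICatStub.{0, 0, 0} T.Dv} {C : TemperedFrobenioid (realified d T) T.Dv VD}

/-- **`h5` — row C38-L05 of the proof of [EtTh] Cor. 3.8 at THE perfection of `C`, for a tempered Frobenioid `C` over
`𝒟_v̲` ON THE ARITHMETIC REALIFIED DATA `realified d T` satisfying S0** (★ p511706's `h5` binder verbatim): ★ p670391's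
`cor38ii_h5_of_carrierSpec` with r1 `hP34Λ := realified_mem_FΛ_of_divΛ_eq_of d T` and r3 `hZQ := realified_isZQMonoprime
d T` (GA-02 ADD-ON 2 ★ p676754) BY NAME — modulo `hF` ([FrdI] Thm. 5.2 (ii); GA-05's result type, hypothesis-free at
the tree vocabulary, §3) ONLY. [cite: MochizukiEtTh2009, Cor 3.8 p.81] -/
theorem cor38ii_h5_of_carrierSpec_realified (hC : CarrierSpec d T C) (hF : PreFrobenioid.IsFrobenioid C.toElem) :
    C.BsFldPreStepLimitCriterion (PreFrobenioidData.perfection hF) :=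
  cor38ii_h5_of_carrierSpec hC hF (realified_mem_FΛ_of_divΛ_eq_of d T) (realified_isZQMonoprime d T)

/-- **`hR` — [EtTh] Remark 3.6.3 OUTRIGHT for every tempered Frobenioid `C` over `𝒟_v̲` on the arithmetic realified data
`realified d T`** (★ p511706's `hR` binder verbatim; "the natural functor `C^{bs-fld} → C` is isomorphism-full", pp.
78–79): ★ p670391's `cor38ii_hR` with r1 `hP34Λ := realified_mem_FΛ_of_divΛ_eq_of d T` and r2 `hFinv :=
realified_exists_inv_FΛ d T` (GA-02 ADD-ON 2 ★ p676754) BY NAME — no hypothesis left.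
[cite: MochizukiEtTh2009, Rmk 3.6.3 p.79] -/
theorem cor38ii_hR_realified (C : TemperedFrobenioid (realified d T) T.Dv VD) : C.Remark363 :=
  cor38ii_hR C (realified_mem_FΛ_of_divΛ_eq_of d T) (realified_exists_inv_FΛ d T)

/-- **[EtTh] Cor. 3.8 (ii) for every SELF-equivalence of a tempered Frobenioid `C` over `𝒟_v̲ = CosetCat Π_v̲` ON THE
ARITHMETIC REALIFIED DATA `realified d T` satisfying S0 and the pull-back dichotomy, `Π_v̲` tempered and slim**: `e`
preserves the base-field-theoretic morphisms AND lifts to a self-equivalence of the REAL hull compatibly with `hull` —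
★ p671786's `hull_selfEquivalence_of_carrierSpec_of_pullDichotomy_of_isSlimGroup` with r1–r3 := GA-02's
`realified_mem_FΛ_of_divΛ_eq_of` / `realified_isZQMonoprime` / `realified_exists_inv_FΛ` BY NAME; modulo `hF` (GA-05's
result type) ONLY. [cite: MochizukiEtTh2009, Cor 3.8 p.81] -/
theorem hull_selfEquivalence_realified_of_pullDichotomy_of_isSlimGroup [IsTopologicalGroup P]
    (hC : CarrierSpec d T C) (hD : CarrierSpec.PullDichotomy C) (hP : IsTempered P) (hZ : IsSlimGroup P)
    (hF : PreFrobenioid.IsFrobenioid C.toElem) (e : C.category ≌ C.category) :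
    (∀ {A B : C.category} (f : A ⟶ B), C.IsBaseFieldTheoretic f ↔ C.IsBaseFieldTheoretic (e.functor.map f)) ∧
      ∃ e' : C.hullCategory ≌ C.hullCategory, Nonempty (C.hull ⋙ e.functor ≅ e'.functor ⋙ C.hull) :=
  hull_selfEquivalence_of_carrierSpec_of_pullDichotomy_of_isSlimGroup hC hD hP hZ hF
    (realified_mem_FΛ_of_divΛ_eq_of d T) (realified_isZQMonoprime d T) (realified_exists_inv_FΛ d T) e

end Realified

section RealifiedTwoObject

variable {p₁ p₂ : ℕ} [Fact p₁.Prime] [Fact p₂.Prime] {d₁ : GaloisValDatum.{0} p₁} {d₂ : GaloisValDatum.{0} p₂}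
  {P₁ P₂ : Type} [Group P₁] [TopologicalSpace P₁] [Group P₂] [TopologicalSpace P₂]
  {T₁ : BadLocalGroupDatum d₁.Gal P₁} {T₂ : BadLocalGroupDatum d₂.Gal P₂}
  {VD₁ : FrdICatStub.{0, 0, 0} T₁.Dv} {VD₂ : FrdICatStub.{0, 0, 0} T₂.Dv}
  {C₁ : TemperedFrobenioid (realified d₁ T₁) T₁.Dv VD₁} {C₂ : TemperedFrobenioid (realified d₂ T₂) T₂.Dv VD₂}

/-- **[EtTh] Cor. 3.8 (ii), two-object form, for tempered Frobenioids `C₁`, `C₂` over `𝒟_{v̲,i} = CosetCat Π_i` ON THE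
ARITHMETIC REALIFIED DATA `realified d_i T_i`**, each satisfying S0 and the pull-back dichotomy, `Π_i` tempered and slim,
and ANY equivalence `Ψ : C₁ ⥲ C₂`: `Ψ` preserves the base-field-theoretic morphisms and induces a compatible equivalence
of the real hulls — §1 with r1–r3 per side := GA-02's `realified_mem_FΛ_of_divΛ_eq_of` / `realified_isZQMonoprime` /
`realified_exists_inv_FΛ` BY NAME; modulo `hF_i` (GA-05's result type) ONLY. [cite: MochizukiEtTh2009, Cor 3.8 p.81] -/
theorem hull_equivalence_realified_of_pullDichotomy_of_isSlimGroup [IsTopologicalGroup P₁] [IsTopologicalGroup P₂]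
    (hC₁ : CarrierSpec d₁ T₁ C₁) (hD₁ : CarrierSpec.PullDichotomy C₁)
    (hC₂ : CarrierSpec d₂ T₂ C₂) (hD₂ : CarrierSpec.PullDichotomy C₂)
    (hP₁ : IsTempered P₁) (hZ₁ : IsSlimGroup P₁) (hP₂ : IsTempered P₂) (hZ₂ : IsSlimGroup P₂)
    (hF₁ : PreFrobenioid.IsFrobenioid C₁.toElem) (hF₂ : PreFrobenioid.IsFrobenioid C₂.toElem)
    (Ψ : C₁.category ≌ C₂.category) :
    (∀ {A B : C₁.category} (f : A ⟶ B), C₁.IsBaseFieldTheoretic f ↔ C₂.IsBaseFieldTheoretic (Ψ.functor.map f)) ∧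
      ∃ Ψbs : C₁.hullCategory ≌ C₂.hullCategory, Nonempty (C₁.hull ⋙ Ψ.functor ≅ Ψbs.functor ⋙ C₂.hull) :=
  hull_equivalence_of_carrierSpec_of_pullDichotomy_of_isSlimGroup hC₁ hD₁ hC₂ hD₂ hP₁ hZ₁ hP₂ hZ₂ hF₁ hF₂
    (realified_mem_FΛ_of_divΛ_eq_of d₁ T₁) (realified_isZQMonoprime d₁ T₁) (realified_exists_inv_FΛ d₁ T₁)
    (realified_mem_FΛ_of_divΛ_eq_of d₂ T₂) (realified_isZQMonoprime d₂ T₂) (realified_exists_inv_FΛ d₂ T₂) Ψ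

end RealifiedTwoObject

/-! ## §3 At the tree category vocabulary: [EtTh] Cor. 3.8 (ii) modulo NOTHING but S0 + the pull-back dichotomy + `Π` tempered ∧ slim -/

section TreeVocab

variable {p : ℕ} [Fact p.Prime] {d : GaloisValDatum.{0} p} {P : Type} [Group P] [TopologicalSpace P]
  [IsTopologicalGroup P] {T : BadLocalGroupDatum d.Gal P} {r s : (T.Dvᵒᵖ ⥤ CommMonCat.{0}) → Prop}
  {C : TemperedFrobenioid (realified d T) T.Dv (treeCatVocab T.Dv r s)}

/-- **[EtTh] Cor. 3.8 (ii) — the shape [IUTchI] Ex. 3.2 (iii) quotes ("`𝒞_v ⊆ ℱ̲_v` … may be reconstructed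
category-theoretically from `ℱ̲_v`") — for EVERY self-equivalence `e` of EVERY tempered Frobenioid `C` over `𝒟_v̲ =
CosetCat Π_v̲` at the tree category vocabulary `treeCatVocab T.Dv r s` (GA-04's `catVocab d T` is `r = s = ⊤`) ON THE
ARITHMETIC REALIFIED DATA `realified d T`, satisfying the decoupling spec S0 and the pull-back dichotomy, `Π_v̲` tempered
and slim — MODULO NOTHING ELSE**.  Every [EtTh] Cor. 3.8 (ii) instance hypothesis is DISCHARGED BY NAME: `hnd` = GA-08's
`isNonDilating_of_carrierSpec hC hD` ★ p671252, `hds` = ★ p511706's `divSlim_cosetCat_of_isSlimGroup`, `hF` = GA-05's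
hypothesis-free `isFrobenioid_realifiedOf` ★ p669819 (`realified d T = realifiedOf d T (deckAction d T) _` by `rfl`),
`h5`/`hR` = GA-14 ★ p670391, r1–r3 = GA-02 ★ p676754.  D7 (GA-07) may one-call this at the term `temperedFrobenioid d T`
with GA-12's `carrierSpec_temperedFrobenioid d T` / `pullDichotomy_temperedFrobenioid d T` ★ p675527; `hC`, `hD` are NOT
assumed inhabited here (typed ≠ inhabited). [cite: MochizukiEtTh2009, Cor 3.8 p.81] -/
theorem hull_selfEquivalence_realified_treeCatVocab_of_isSlimGroup (hC : CarrierSpec d T C)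
    (hD : CarrierSpec.PullDichotomy C) (hP : IsTempered P) (hZ : IsSlimGroup P) (e : C.category ≌ C.category) :
    (∀ {A B : C.category} (f : A ⟶ B), C.IsBaseFieldTheoretic f ↔ C.IsBaseFieldTheoretic (e.functor.map f)) ∧
      ∃ e' : C.hullCategory ≌ C.hullCategory, Nonempty (C.hull ⋙ e.functor ≅ e'.functor ⋙ C.hull) :=
  hull_selfEquivalence_realified_of_pullDichotomy_of_isSlimGroup hC hD hP hZ
    (isFrobenioid_realifiedOf d T (deckAction d T) (Envelope.cuspLaws (Cpt d T)) C) e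

end TreeVocab

section TreeVocabTwoObject

variable {p₁ p₂ : ℕ} [Fact p₁.Prime] [Fact p₂.Prime] {d₁ : GaloisValDatum.{0} p₁} {d₂ : GaloisValDatum.{0} p₂}
  {P₁ P₂ : Type} [Group P₁] [TopologicalSpace P₁] [IsTopologicalGroup P₁] [Group P₂] [TopologicalSpace P₂]
  [IsTopologicalGroup P₂] {T₁ : BadLocalGroupDatum d₁.Gal P₁} {T₂ : BadLocalGroupDatum d₂.Gal P₂}
  {r₁ s₁ : (T₁.Dvᵒᵖ ⥤ CommMonCat.{0}) → Prop} {r₂ s₂ : (T₂.Dvᵒᵖ ⥤ CommMonCat.{0}) → Prop}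
  {C₁ : TemperedFrobenioid (realified d₁ T₁) T₁.Dv (treeCatVocab T₁.Dv r₁ s₁)}
  {C₂ : TemperedFrobenioid (realified d₂ T₂) T₂.Dv (treeCatVocab T₂.Dv r₂ s₂)}

/-- **[EtTh] Cor. 3.8 (ii) in print's two-object generality, MODULO NOTHING but S0 + the pull-back dichotomy + `Π_i`
tempered ∧ slim**: for ANY two tempered Frobenioids `C₁`, `C₂` over `𝒟_{v̲,i} = CosetCat Π_i` at tree category
vocabularies on the ARITHMETIC realified data `realified d_i T_i`, and ANY equivalence `Ψ : C₁ ⥲ C₂`, `Ψ` preserves the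
base-field-theoretic morphisms and induces a compatible equivalence `Ψbs : C₁^{bs-fld} ⥲ C₂^{bs-fld}` of the REAL hulls
(`hull₁ ⋙ Ψ ≅ Ψbs ⋙ hull₂`) — the functoriality in `Ψ` behind "`𝒞_v ⊆ ℱ̲_v` reconstructed category-theoretically from
`ℱ̲_v`" ([IUTchI] Ex. 3.2 (iii)).  All instance hypotheses DISCHARGED BY NAME per side (`hnd_i` GA-08, `hds_i` ★ p511706,
`hF_i` GA-05's `isFrobenioid_realifiedOf`, `h5_i`/`hR_i` GA-14, r1–r3 GA-02); `hC_i`, `hD_i` and `Ψ` are HYPOTHESES (typed ≠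
inhabited). [cite: MochizukiEtTh2009, Cor 3.8 p.81] -/
theorem hull_equivalence_realified_treeCatVocab_of_isSlimGroup
    (hC₁ : CarrierSpec d₁ T₁ C₁) (hD₁ : CarrierSpec.PullDichotomy C₁)
    (hC₂ : CarrierSpec d₂ T₂ C₂) (hD₂ : CarrierSpec.PullDichotomy C₂)
    (hP₁ : IsTempered P₁) (hZ₁ : IsSlimGroup P₁) (hP₂ : IsTempered P₂) (hZ₂ : IsSlimGroup P₂)
    (Ψ : C₁.category ≌ C₂.category) :
    (∀ {A B : C₁.category} (f : A ⟶ B), C₁.IsBaseFieldTheoretic f ↔ C₂.IsBaseFieldTheoretic (Ψ.functor.map f)) ∧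
      ∃ Ψbs : C₁.hullCategory ≌ C₂.hullCategory, Nonempty (C₁.hull ⋙ Ψ.functor ≅ Ψbs.functor ⋙ C₂.hull) :=
  hull_equivalence_realified_of_pullDichotomy_of_isSlimGroup hC₁ hD₁ hC₂ hD₂ hP₁ hZ₁ hP₂ hZ₂
    (isFrobenioid_realifiedOf d₁ T₁ (deckAction d₁ T₁) (Envelope.cuspLaws (Cpt d₁ T₁)) C₁)
    (isFrobenioid_realifiedOf d₂ T₂ (deckAction d₂ T₂) (Envelope.cuspLaws (Cpt d₂ T₂)) C₂) Ψ

end TreeVocabTwoObject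

end ArithThetaTower

end Literature.AnabelianGeometry.EtaleTheta

end
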